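import Summits.BirchSwinnertonDyer.BirchSwinnertonDyer.Theses.KatoDescentPotSupersingular
import Literature.NumberTheory.EllipticCurves.Kato2004.IwasawaCohomologyExistsProofs
import HarnessLib

/-!
# K9 `KatoDescentPotSupersingular`: the held published input `PublishedInputIwasawaH1Data`
# (item stmt-BirchSwinnertonDyer-19654, child of crux M 19196 `ReducibleKatoMember`) is a THEOREM

Seat `bsd-potss-rkm` (prover, cell `bsd-potss`).  The split child 19654 of crux M is the bare alias of
the named Literature fact `Kato2004.nonempty_iwasawaH1Data` (Kato 2004 §12.2 (12.2.1): the Iwasawa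
cohomology `𝐇¹_Γ(T_pW)` exists as a `Λ`-module), which is PROVED in the kernel by
`Kato2004.nonempty_iwasawaH1Data_holds` (`Literature/…/Kato2004/IwasawaCohomologyExistsProofs.lean`:
Weierstrass division by `ω_n = (X+1)^{p^n} − 1` + `conj_γ^{p^n} = 1` on `H¹(ℚ_n, T_pW)`).  Hence the
K9 route loses this cite-level input: the trust base of the glue `ReducibleKatoMemberOfHullInputs`
(19660, closed) shrinks to `PublishedInputNewformKato` (modularity) and
`PublishedInputMemberHullInputs` (Kato §§12–14 at the member).  HONEST FRAMING: a construction fact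
with no arithmetic content; closes rung leaf 19654 of BirchSwinnertonDyer, never summit credit; BSD
is not advanced by it.
-/

set_option linter.dupNamespace false

namespace Summit.BirchSwinnertonDyer.BirchSwinnertonDyer.Theorems

/-- **Item 19654 (K9 decl) proved**: `PublishedInputIwasawaH1Data` — by name the Literature theorem
`Kato2004.nonempty_iwasawaH1Data_holds`. [cite: Kato2004Asterisque, §12.2 (12.2.1) (p. 220)] -/
theorem publishedInputIwasawaH1Data_proof :
    Summit.BirchSwinnertonDyer.BirchSwinnertonDyer.Theses.KatoDescentPotSupersingular.PublishedInputIwasawaH1Data :=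
  Literature.NumberTheory.EllipticCurves.Kato2004.nonempty_iwasawaH1Data_holds

end Summit.BirchSwinnertonDyer.BirchSwinnertonDyer.Theorems
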